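import Mathlib
import HarnessLib
import HarnessLib.Audit
import Summits.AtomisticToContinuum.Statement
import Literature.Barriers.AtomisticToContinuum.HighMomentumCutoff

/-!
Route: AprioriTailsRattlers

CLOSED (retired) 2026-08-15T13:38:28Z by operator:999:1257524 — reason: not-a-thesis: assembly does not conclude the sub-problem Statement — note: D-0027 §2.1 audit (human 2026-08-15: routes that do not decide the summit are removed): the assembly concludes `Literature.MathematicalPhysics.KineticTheory.HydrodynamicLimit`, not the sub-problem statement; a NEW conforming route may be opened from the same idea (generated `closes : … → _root_.Hydr. The file is kept as the record of this route; refuted decls are indexed as negative knowledge (`ledger negatives`).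

# Route AprioriTailsRattlers — Velocity tails by pathwise Povzner with fast spheres in a Lorentz
gas, rattlers by contact-intensity domination — the a priori module every flux route needs

It suffices to show the A PRIORI MODULE X = (T) ∧ (R) of card apriori-tails-and-rattlers (absorbing
fast-particle-energy-cascade and ballistic-tail-lorentz-decorrelation), together with the consumer
statement (C) that the flux routes already carry:
(T) GaussianVelocityTails — along the deterministic hard-sphere flow from local Gibbs data, for
every profile and σ < σ₀(profiles), uniform-in-N Gaussian velocity moments E[(N+1)⁻¹Σᵢ
exp(c|vᵢ(t)|²)] ≤ C on [0,T]: Nachtergaele–Yau's cutoff II.1 = the barrier file's open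
`HighMomentumCutoff σ` with the conjunct's closure (σ₀ after the profiles);
(R) ContactIntensityDomination — the time-integrated mean INCOMING CONTACT INTENSITY under f_t
(expected sum over collisions of any continuous φ ≥ 0 of the two pre-collisional velocities) is at
most C·ν_N·(N+1)·∫∫φ(v,w)|v−w| dF_τ(v)dF_τ(w) dτ, ν_N = σ²(N+1)^{1/3}, F_τ = mean empirical velocity
law: "no more collisions, weighted any way, than C × Boltzmann–Enskog built from the one-particle
law" — it contains the rattler/collisional-pressure bound (MeanCollisionalImpulseBound: E Σ_coll
ε|Δv| ≤ C(N+1)σ³(t−s)) and the gain half of (T);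
(C) ConditionalEulerLimit — (T) → (R) → HydrodynamicLimit, the conditional Euler limit that
RelEntropyErgodic (0780 given 0781), DissipativeWeakStrong (FluxClosure 0823 tightness),
kinetic-windows-inside-yau and ld-drude-flux-gibbsianity each claim to deliver GIVEN the module; it
is filed as a support item so that the Assembly is honest glue, and is not this route's bet.
(T) itself is reached in two typed layers: three dynamical cruxes about collisions of (mostly fast)
spheres — FastParticleCollisionRate (loss: fast spheres collide at rate ≥ cν_N|v|),
EnergySplitEquidistribution (angular: the post-collisional energy split is spread, E^p-weighted mean
of u^p+(1−u)^p ≤ C/(p+1)), ContactIntensityDomination (gain) — feed, through the exact pathwise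
identity ΔΣ|vᵢ|^{2p} = E^p[h_p(u⁺) − h_p(u⁻)] per collision (PathwisePovzner, MomentBookkeeping),
the N-body-in-the-mean Povzner hierarchy (PovznerHierarchy), and an abstract
Bobylev–Gamba–Panferov/ACGM propagation lemma (AbstractPovznerGaussian, crux 5, pure analysis) turns
the hierarchy into Gaussian moments uniformly in N because ν_N → ∞ only rescales time.
Lean: `GaussianVelocityTails ∧ ContactIntensityDomination ∧ ConditionalEulerLimit` (decls of this
route file; their one-line bodies over existing declarations —
Literature.MathematicalPhysics.KineticTheory.localGibbsLaw / hsDiameter / HydrodynamicLimit,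
Literature.Analysis.FluidPDE.HardSphereFlow.flow / collisionTimes / contactSet / collidePair,
Literature.Barriers.AtomisticToContinuum.expVelocityMoment — are the items below; all 13 decls
elaborate rc 0 in folder/Sketch.lean)

## Assembly
Pure logic once the items are read as implications: MomentBookkeeping turns the three dynamical
cruxes into PovznerHierarchy; HierarchyToGaussian (with the abstract lemma AbstractPovznerGaussian)
turns the hierarchy into GaussianVelocityTails; ConditionalEulerLimit consumes GaussianVelocityTails
and ContactIntensityDomination and returns the conjunct. All the mathematics sits in the cruxes, the
two glue items and the consumer; the Assembly item is a seven-fold modus ponens.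

Rationale: WHY THIS LINE. Every argument that takes expectations of microscopic FLUXES under the true law f_t
(Yau/OVY Gronwall, flux tightness for measure-valued limits, kinetic windows) meets two unbounded
quantities that order-N relative entropy provably cannot see: the cubic energy current (velocity
TAILS; the HighMomentumCutoff barrier, NachtergaeleYau2003 §2.3 "no proof even in the classical
case", OllaVaradhanYau1993 §1) and the collisional momentum transfer (RATTLERS: a δ-gapped pair
costs log(1/δ) nats, and on 𝕋³ there is no Clausius-virial bound on the total collisional stress
since ∫∇V = 0). The line imports the moment method of the spatially homogeneous Boltzmann theory —
Povzner's inequality (CercignaniIllnerPulvirenti1994 §6.2 Lemma 6.2.1, App. 6.B) in its sharp form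
with angular factor γ_p = O(1/p) and the creation/propagation of exponential moments (Bobylev1997,
BobylevGambaPanferov2004, GambaPanferovVillani2009, AlonsoEtAl2013, MischlerWennberg1999;
uniform-in-N for the STOCHASTIC N-particle process in MischlerMouhot2012) — and points it at the
deterministic N-body flow IN THE MEAN: the per-collision identity is algebra valid along the flow,
so the only statistical inputs are three one-sided, constant-factor statements about the collision
intensity measure, and these concern mostly FAST spheres, which outrun their own correlations and
see a frozen Lorentz gas of fresh targets (Spohn1991 Part I,
BodineauGallagherSaintRaymondInvent2016) — molecular chaos in its easiest instance, used only as
inequalities. What is new relative to the five open routes: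
RelEntropyErgodic/VanishingNoise/ChaoticMixing carry LargeVelocityControl 0781 in an
exponential-cubic form that is infinite already at t = 0 (barrier file, scope caveat (f)); this
route replaces it by the Gaussian statement with a mechanism, and isolates (R) — invisible to
entropy and to pointwise domination f_t ≤ e^{cN}G — as a typed contact-intensity statement that also
serves DissipativeWeakStrong's flux tightness and the Serre-CI sibling card. No prior route or
negative (index empty) touches collision statistics along f_t.

RANKED CRUXES. #2 FastParticleCollisionRate (crux) — LOSS / NO CHANNELLING (card cruxes 1–2, rate
part): for all profiles ∃σ₀ ∀σ<σ₀ ∀T ∀flows ∃K₀, c>0, N₀ such that for N ≥ N₀, every p ∈ ℕ and 0 ≤ s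
≤ t ≤ T: c·σ²(N+1)^{1/3}·∫_s^t E[(N+1)⁻¹ Σ_{i:|vᵢ(τ)|>K₀} |vᵢ(τ)|^{2p+1}] dτ ≤ E[Σ over collisions
in (s,t] and ordered contact pairs (i,j) of 1{|vᵢ⁻|>K₀}(N+1)⁻¹|vᵢ⁻|^{2p}] (pre-collisional velocity
vᵢ⁻ = collidePair of the post configuration): fast spheres collide at rate at least c ν_N |v|, in
the |v|^{2p}-weighted time-integrated mean, uniformly in p — a fast sphere sweeps volume πε²|v|dt of
fresh, frozen, locally-Gibbs targets (Lorentz gas). [difficulty: open-problem] (why it might fail: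
Channelling: dynamically created fast spheres might sit in co-moving or depleted corridors (wakes,
jets) and collide at mean rate ≪ ν_N|v|; entropy cannot exclude it (tail energy is entropically
free) and no lower bound on collision rates of a sub-population of a deterministic gas is in print.)
[Spohn1991, BodineauGallagherSaintRaymondInvent2016, GST2013, MischlerMouhot2012]
#3 ContactIntensityDomination (crux) — GAIN / RATTLERS = (R): for all profiles ∃σ₀ ∀σ<σ₀ ∀T ∀flows
∃C<∞, N₀ such that for N ≥ N₀, 0 ≤ s ≤ t ≤ T and every continuous φ : V3×V3 → [0,∞]: E[Σ_{collisions
in (s,t]} Σ_{ordered contact pairs (i,j)} φ(vᵢ⁻, vⱼ⁻)] ≤ C·(ν_N/(N+1))·∫_s^t E⊗E[Σᵢ Σⱼ φ(vᵢ(τ,z),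
vⱼ(τ,z′))·|vᵢ(τ,z) − vⱼ(τ,z′)|] dτ (two independent copies z, z′ of the initial law): the
time-integrated incoming contact intensity of f_τ^{(2)} is dominated by C × the Boltzmann–Enskog
intensity ν_N|v−w|F_τ⊗F_τ of the mean one-particle velocity law. With φ ≡ 1 it bounds the mean
collision count by C×Enskog, with φ = ε|v−w| the mean collisional impulse
(MeanCollisionalImpulseBound), with φ = mixed binomial monomials the gain term of the Povzner
hierarchy. [difficulty: open-problem] (why it might fail: Sub-LD clustering: transient
micro-clusters (rattlers) or velocity-correlated incoming pairs formed along f_t could push the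
time-averaged contact trace above C|v−w|F⊗F; needs L∞-type control of the pair trace at contact,
open beyond Lanford time; focusing inflates C (∝ 1/hot-spot volume).) [GST2013,
PulvirentiSimonella2016, BuragoFerlegerKononenko1998, Alexander1975, Spohn1991]
#4 EnergySplitEquidistribution (crux) — ANGULAR (card crux 1, non-grazing in the mean, in the form
the moment method consumes): ∃C<∞, N₀: for N ≥ N₀, p ≥ 1, 0 ≤ s ≤ t ≤ T: E[Σ_coll Σ_ord
(N+1)⁻¹(|vᵢ⁺|^{2p}+|vⱼ⁺|^{2p})] ≤ (C/(p+1))·E[Σ_coll Σ_ord (N+1)⁻¹(|vᵢ⁺|²+|vⱼ⁺|²)^p], i.e. the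
pair-energy^p-weighted collision average of h_p(u⁺) = (u⁺)^p + (1−u⁺)^p (u⁺ = post-collisional
energy fraction) decays like 1/(p+1). Kinematics (NOTES): for hard spheres with impact parameter
uniform on the disk, u⁺ is uniform on an interval centred at 1/2 of width 2|V||g|/E, so E_ω h_p(u⁺)
≤ 2/(p+1) for EVERY pre-collisional pair; hence the crux follows from a bounded density of the
impact-parameter law (w.r.t. uniform) in the E^p-weighted collision mean; rattling co-moving pairs
have u⁺ ≈ 1/2 and are harmless here. [difficulty: L] (why it might fail: Grazing-dominated
statistics for energetic collisions (a fast sphere skimming a wake; impact parameters piling up near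
b = ε) push the weighted mean of u^p+(1−u)^p to 1 and kill the 1/(p+1) decay; then only order-1
exponential tails survive and crux 5 does not apply as stated.) [CercignaniIllnerPulvirenti1994,
BobylevGambaPanferov2004, GST2013]
#5 AbstractPovznerGaussian (crux) — ABSTRACT PROPAGATION LEMMA (pure analysis;
Bobylev–Gamba–Panferov / ACGM uniform-in-time Gaussian propagation, abstracted from the kernel): for
all p₀, K₀ ≥ 0, c > 0, C ≥ 0, E₀, C₀, A there are b > 0, B < ∞ such that for every ν > 0, horizon S
and family u ↦ μ_u of measures on ℝ³ with mass ≤ 1, second moments ≤ E₀ on [0,S], each even moment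
bounded on [0,S], Gaussian initial moments M_{2p}(0) ≤ C₀A^p p!, and the integrated hierarchy
M_{2p}(u₂) + cν∫_{u₁}^{u₂}M_{2p+1} ≤ M_{2p}(u₁) + ν∫_{u₁}^{u₂}[C K₀^{2p+1} + (C/(p+1)) Σ_{0<k<p}
C(p,k)(M_{2k+1}M_{2p−2k} + M_{2k}M_{2p−2k+1})] for p ≥ p₀, 0 ≤ u₁ ≤ u₂ ≤ S: sup_{u≤S}
∫exp(b|v|²)dμ_u ≤ B — b, B independent of ν, S, μ (ν only rescales time; the comparison bounds are
sup-bounds). This is the item provers can close now; it converts PovznerHierarchy into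
GaussianVelocityTails (HierarchyToGaussian). [difficulty: L] (why it might fail: The abstraction may
be too weak (hierarchy only from p₀ on, loss/gain constants decoupled, no time-continuity, mass ≤ 1
not = 1): if order-2 summability fails under exactly these hypotheses the conclusion drops to
exp(b|v|) moments and the item must be restated (grounder check vs BGP04/ACGM13).) [Bobylev1997,
BobylevGambaPanferov2004, AlonsoEtAl2013, GambaPanferovVillani2009, MischlerWennberg1999,
CercignaniIllnerPulvirenti1994]
#9 GaussianVelocityTails (support) — (T), the module's tail output: for all profiles ∃σ₀ ∀σ<σ₀ ∀T>0
∀flows ∃c>0, C<∞, N₀: ∀N ≥ N₀ ∀t ∈ [0,T], ∫ expVelocityMoment c (Φ_N(t) z) dλ^N ≤ C — the body of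
Literature.Barriers.AtomisticToContinuum.HighMomentumCutoff σ with the conjunct's closure (σ₀ after
the profiles, N ≥ N₀); wanted by RelEntropyErgodic (restated 0781), VanishingNoise, ChaoticMixing,
chapman-enskog-corrector, kinetic-windows-inside-yau, first-failure-blowup,
spacetime-superextensive-ld (max-speed corollary). Obtained here as HierarchyToGaussian ∘
MomentBookkeeping. [difficulty: open-problem] [NachtergaeleYau2003, OllaVaradhanYau1993]
#9 PovznerHierarchy (support) — HUB STATEMENT (typed N-body-in-the-mean Povzner system; = glue
target of MomentBookkeeping, hypothesis of HierarchyToGaussian; direct attack welcome): for all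
profiles ∃σ₀ ∀σ<σ₀ ∀T ∀flows ∃p₀, K₀≥0, c>0, C≥0, E₀, C₀, A, N₀ such that for N ≥ N₀, with M_r(τ) :=
E[(N+1)⁻¹Σᵢ|vᵢ(τ)|^r] and ν = σ²(N+1)^{1/3}: mass λ^N(univ) ≤ 1; M_2 ≤ E₀ on [0,T]; each M_{2p}
bounded on [0,T] (N-dependent bound allowed); M_{2p}(0) ≤ C₀A^p p!; and for p ≥ p₀, 0 ≤ s ≤ t ≤ T:
M_{2p}(t) + cν∫_s^t M_{2p+1} ≤ M_{2p}(s) + ν∫_s^t [C K₀^{2p+1} + (C/(p+1))·S_p], S_p = Σ_{0<k<p}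
C(p,k)(M_{2k+1}M_{2p−2k} + M_{2k}M_{2p−2k+1}) (BGP form with γ_p ≤ C/(p+1)). [difficulty:
open-problem] [Bobylev1997, BobylevGambaPanferov2004, AlonsoEtAl2013]
#9 MeanCollisionalImpulseBound (support) — (R) AS CONSUMED (collisional stress / rattler payload is
extensive): for all profiles ∃σ₀ ∀σ<σ₀ ∀T ∀flows ∃C<∞, N₀: for N ≥ N₀ and 0 ≤ s ≤ t ≤ T,
E[Σ_{collisions in (s,t]} Σ_ord ε_N |vᵢ⁺ − vᵢ⁻|] ≤ C·(N+1)·σ³·(t−s) (ε_N = σ(N+1)^{-1/3}; per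
collision this is 2ε|g·ω|; Enskog value ≍ Nσ³√θ per unit time): the mean collisional momentum
transfer per particle per unit macroscopic time is O(σ³) — the tightness input of FluxClosure 0823
(DissipativeWeakStrong) and the collisional residual of every Gronwall route; shared target with
card serre-compensated-integrability-cluster-payload. Follows from ContactIntensityDomination with φ
= ε|v−w| and the energy bound (glue ≤ 60 lines, not filed). [difficulty: M] [Spohn1991, GST2013]
#9 TailsOfHighMomentumCutoff (support) — LINK TO THE BARRIER CATALOGUE (provable now, pure logic):
if the barrier file's open hypothesis holds for all small σ, (∃σ₀>0 ∀σ∈(0,σ₀),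
Literature.Barriers.AtomisticToContinuum.HighMomentumCutoff σ), then GaussianVelocityTails
(instantiate profiles, take the same σ₀, N₀ = 0). [difficulty: provable-now] [NachtergaeleYau2003]
#9 HierarchyToGaussian (support) — GLUE (T-side, layer 2 → layer 1): AbstractPovznerGaussian →
PovznerHierarchy → GaussianVelocityTails. Instantiate the abstract lemma with ν := σ²(N+1)^{1/3}, S
:= T and μ_u := the mean empirical velocity law at time u, (N+1)⁻¹ Σᵢ (λ^N).map (z ↦ vᵢ(Φ_N(u)z));
its moments are the M_r of PovznerHierarchy (lintegral over sum/smul/map, ofReal of a nonnegative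
sum), and ∫exp(b|v|²)dμ_t = ∫ expVelocityMoment b (Φ_N(t)z) dλ^N; b, B do not depend on N because
they do not depend on ν, S, μ. [glue] [deps: AbstractPovznerGaussian, PovznerHierarchy,
GaussianVelocityTails] [difficulty: M] [AlonsoEtAl2013, BobylevGambaPanferov2004]
#9 MomentBookkeeping (support) — GLUE (the pathwise heart; layer 2 → hub): FastParticleCollisionRate
→ ContactIntensityDomination → EnergySplitEquidistribution → PovznerHierarchy. For good z the speeds
are constant between the finitely many collisions in (s,t]
(IsHardSphereTrajectory.free/locFinite/binary) and each collision of the pair (i,j) with pair energy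
E and post fraction u⁺ changes S_p = (N+1)⁻¹Σ|vᵢ|^{2p} by (N+1)⁻¹[E^p h_p(u⁺) − |vᵢ⁻|^{2p} −
|vⱼ⁻|^{2p}] (PathwisePovzner; pre = collidePair of post); hence M_{2p}(t) + E[Σ pure(pre)] =
M_{2p}(s) + E[Σ post-pure]; ANGULAR bounds E[Σ post-pure] ≤ γ_p E[Σ E^p] with γ_p = C_a/(p+1), E^p =
pure(pre) + mixed(pre), UPPER with φ = mixed_p bounds E[Σ mixed(pre)] ≤ C_u ν ∫ S_p (independent
copies factorise) and also makes E[Σ E^p] finite at fixed N, LOWER bounds E[Σ pure(pre)] ≥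
(c/2)ν∫(M_{2p+1} − K₀^{2p+1}); for p ≥ p₀ := ⌈2C_a⌉ this is the hierarchy with c′ = c/4, C′ =
max(c/2, C_aC_u/2). Mass ≤ 1, M_2 ≤ E₀ (energy conservation, configEnergy_eq_holds), finite-N bounds
D_p and Gaussian initial moments come from the explicit local Gibbs density. Measure-theoretic
plumbing (measurability of collision functionals as limits over partitions; exchange of finite sums
and lintegrals) rides here via --supports. [glue] [deps: FastParticleCollisionRate,
ContactIntensityDomination, EnergySplitEquidistribution, PovznerHierarchy, PathwisePovzner]
[difficulty: L] [CercignaniIllnerPulvirenti1994, GST2013, BobylevGambaPanferov2004]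
#9 ConditionalEulerLimit (support) — CONSUMER (not this route's bet; as hard as the flux routes that
claim it): GaussianVelocityTails → ContactIntensityDomination → HydrodynamicLimit — the conditional
Euler limit given the a priori module, i.e. what RelEntropyErgodic's Gronwall 0780 (given tails, in
place of 0781), DissipativeWeakStrong's FluxClosure 0823 (given tightness of the flux measures),
kinetic-windows-inside-yau and ld-drude-flux-gibbsianity each promise; filed so that the Assembly is
honest glue and so that those routes can attach (wanted_by). Nachtergaele–Yau's Thm 2.1 is the
printed template of such a conditional theorem (for fermions, with the ergodic input also assumed).
[deps: GaussianVelocityTails, ContactIntensityDomination] [difficulty: open-problem]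
[OllaVaradhanYau1993, NachtergaeleYau2003, Spohn1991]
#9 PathwisePovzner (support) — THE PER-COLLISION ALGEBRA (provable now from
norm_sq_reflectVel_fst_add_norm_sq_reflectVel_snd and the binomial theorem): for the elastic
reflection (v′,w′) = reflectVel n (v,w) and p ≥ 1, |v′|^{2p} + |w′|^{2p} ≤ (|v|²+|w|²)^p, and
(|v|²+|w|²)^p = |v|^{2p} + |w|^{2p} + Σ_{0<k<p} C(p,k)|v|^{2k}|w|^{2p−2k}: post-collisional pure
moments are bounded by the conserved pair energy^p, which exceeds the pre-collisional pure moments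
exactly by the mixed binomial terms — Povzner's inequality "generalizes the conservation of energy,
taking into account compensation between gain and loss" (CIP 1994 p. 172), valid along the
deterministic flow with no Stosszahlansatz. [difficulty: provable-now]
[CercignaniIllnerPulvirenti1994]

TWO-LAYER PLAN. Foreseen glued splits, none filed now (D-0019): FastParticleCollisionRate ⇐
FreshTargetLemma (a tagged sphere of speed V ≥ K₀ in a background entropy-close to local Gibbs
meets, over one flight time, an incoming-contact intensity ≥ c ν_N V: re-encounter probability ≲
(v_th/V)σ³, Lorentz/Rayleigh-gas structure à la Spohn1991 I.8,
BodineauGallagherSaintRaymondInvent2016) → CorridorStatistics (the mean volume fraction of depleted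
co-moving corridors ahead of fast spheres is ≤ 1 − c, inherited from the bulk one flight time
earlier) → FastParticleCollisionRate. ContactIntensityDomination ⇐ ClusterDispersion (deterministic:
Lagrange–Jacobi d²I/dt² ≥ 2KE_int for isolated clusters + BuragoFerlegerKononenko1998 collision
counting ⇒ payload of a δ-gapped k-cluster per flight time ≤ C(k)/δ) → ClusterFormationRate (under
f_t: expected number of k-clusters with gaps < δε formed per flight time ≤ C N (Cσ³)^{k−1} δ^{m(k)},
m(k) > 1) → ContactIntensityDomination. EnergySplitEquidistribution ⇐ ImpactLawDensityBound
(E^p-weighted impact-parameter law of collisions has density ≤ C w.r.t. uniform on the disk) →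
SplitKinematics (provable: u⁺ uniform on a centred interval under uniform b, so E h_p ≤ 2/(p+1)) →
EnergySplitEquidistribution. Glue UPPER → MeanCollisionalImpulseBound (φ = ε|v−w|, M_2 ≤ E₀) to be
filed when a consumer route attaches.

KILL CRITERIA. ¬FastParticleCollisionRate with a positive-mean channelling mechanism closes the (T)
mechanism: close --reason refuted:FastParticleCollisionRate unless the refutation is p-non-uniform
only (then restate with p-dependent c_p, which still yields polynomial moments and CubicUI — pivot
GaussianVelocityTails → PolynomialVelocityTails). ¬ContactIntensityDomination (rattler floods or
contact velocity-correlations with positive mean weight under f_t) refutes (R) for EVERY flux route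
on the board — close this route and report to the tenure planners of
DissipativeWeakStrong/RelEntropyErgodic (their tightness/collisional residual inputs die with it).
¬EnergySplitEquidistribution → pivot, not kill: restate
AbstractPovznerGaussian/GaussianVelocityTails at exponential order 1 (exp(b|v|) moments; enough for
CubicUI/flux-tightness consumers, not for NY §7.2). ¬AbstractPovznerGaussian → restate with the
missing hypothesis (grounder-level repair). Mooted: if HighMomentumCutoff σ lands as a Literature
theorem (TailsOfHighMomentumCutoff makes (T) immediate); if a Serre-CI route proves
MeanCollisionalImpulseBound, (R)-as-consumed is moot but ContactIntensityDomination stays wanted for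
the gain term.

NOT DECOMPOSED YET. The proof plans of the three dynamical cruxes (Two-layer plan) — children only
after a refuter pass on the parents; the trace formula E[Σ_coll φ] = ∫∫_{incoming contact} φ
f_τ^{(2)} |g·ω| (GST2013 Ch. 4-type, for the transported canonical density) and joint
(τ,z)-measurability of collision functionals, which ride with MomentBookkeeping via --supports; the
glue ContactIntensityDomination → MeanCollisionalImpulseBound; the max-speed corollary P(sup_{s≤t}
maxᵢ|vᵢ(s)| > c√log N) → 0 wanted by spacetime-superextensive-ld (Chebyshev + union over collision
events; file when that card is routed); a position-resolved (local) version of UPPER with φ(x,v,w),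
which would sharpen C away from 1/hot-spot-volume; the restatement of 0781 inside RelEntropyErgodic
(tenure planner's call: replace by GaussianVelocityTails).

CHEAPEST FALSIFIER. (i) One hour with BobylevGambaPanferov2004 Thm 1–2 / AlonsoEtAl2013 Thm 2: check
that uniform-in-time Gaussian PROPAGATION for hard spheres uses nothing beyond the hypotheses of
AbstractPovznerGaussian (mass, energy, Gaussian data, the γ_p = O(1/p) hierarchy from some p₀ on);
if it needs m₀ = 1 exactly or the hierarchy from p = 1, restate. (ii) The kinematic lemma behind
crux 4 (u⁺ uniform on [1/2 − |V||g|/E, 1/2 + |V||g|/E] under uniform impact parameter; E h_p ≤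
2/(p+1)) is a two-line computation — a refuter should redo it. (iii) Event-driven MD at packing
fraction 0.05, N ∈ {10³,10⁴,10⁵}, strongly sheared/compressive local-Gibbs data: collision rate of
the fastest 0.1% vs ν_N|v| (crux 2 predicts ratio ≥ c uniformly in N), E^p-weighted mean of h_p(u⁺)
vs 2/(p+1) for p = 2..8 (crux 4), total Σ_coll ε|Δv| per particle per unit time vs its Enskog value
and the largest transient cluster (crux 3); any growth with N kills the corresponding crux. Not run
here (hub compute-free; recommended as the refuter's first kit job).

NUMBERS. ε_N = σ(N+1)^{-1/3}; ν_N = (N+1)ε_N² = σ²(N+1)^{1/3} (collisions per particle per unit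
macroscopic time, up to the thermal speed); ν_N ε_N = σ³ (collisional/kinetic pressure ratio ≍
(2π/3)ρσ³ = second virial term of hsCompressibility); mean free path/diameter = σ^{-3}. Under
uniform impact parameter the post-collisional energy fraction u⁺ of one partner is uniform on an
interval centred at 1/2 of width 2|V||g|/(|v|²+|w|²) ≤ 1, so γ_p = sup E_ω[(u⁺)^p + (1−u⁺)^p] =
2/(p+1) (attained at |V||g| = E/2), the hard-sphere value in BobylevGambaPanferov2004; co-moving
(rattling) pairs have width → 0 and h_p → 2^{1−p}. Entropy no-go (card, checked): moving an energy
fraction x into particles of speed K costs ≈ (3/2)xN nats independently of K, so H(f_t|G) = O(N)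
bounds no K-dependent tail; 0781's exp-cubic form is infinite at t = 0 for every λ > 0.

DEFINITION REQUESTS. None required: the collision API of
Literature/Analysis/FluidPDE/HardSphereDynamics.lean (collisionTimes, contactSet, collidePair — the
pre-collisional configuration is collidePair of the right-continuous post-collisional one by
`IsHardSphereTrajectory.binary` and `collidePair_collidePair`) types every item; a named
`collisionSum` functional (finsum over collisionTimes ∩ Ioc s t of a pair functional) in that file
would shorten the four collision-sum signatures and is suggested, not requested. Bib keys added this
session: Bobylev1997, BobylevGambaPanferov2004, GambaPanferovVillani2009, AlonsoEtAl2013,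
MischlerMouhot2012, MischlerWennberg1999, BuragoFerlegerKononenko1998.

Novelty: Searches (2026-08-15): lit search --hybrid "Povzner inequality exponential moments Gaussian
propagation hard spheres Boltzmann" (8 held books; CercignaniIllnerPulvirenti1994 §6.2 Lemma 6.2.1
p. 172 + App. 6.B read: Povzner "generalizes the conservation of the energy, taking into account
compensation between the gain and the loss"; SaintRaymond2009, RezakhanlouVillani2008 entropy
methods); lit search --source crossref "Gamba Panferov Villani upper Maxwellian bounds"
(doi:10.1007/s00205-009-0250-9) and "propagation of Gaussian moments Boltzmann hard spheres uniform
in time particle system" (6 rows, nothing on deterministic N-body moments); lit cite ×7 (bib keys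
above); lit galaxy search "…Povzner… N-particle hard sphere…" --star all ×3: service saturated
(queued > 90 s), logged; openalex budget exhausted; plus the card's audit (crossref ×5, zbMATH:
Povzner 1962, Bobylev1997, MischlerWennberg1999, arXiv:math/0701081, AlonsoEtAl2013,
MischlerMouhot2012 Kac program, Arkeryd 1990 Enskog) and the cards fast-particle-energy-cascade /
ballistic-tail-lorentz-decorrelation (merged here) and
serre-compensated-integrability-cluster-payload (sibling mechanism for (R) via Serre's compensated
integrability, arXiv:2002.09157).
Nearest prior art found: Bobylev1997 and BobylevGambaPanferov2004 (sharp Povzner with γ_p = O(1/p),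
propagation of Gaussian moments for the homogeneous hard-sphere BOLTZMANN equation);
MischlerMouhot2012 (uniform-in-N moment propagation for the STOCHASTIC Kac N-particle  [refs: 10.1007/s00205-009-0250-9, math/0701081, 2002.09157, doi:10.1007/s00205-009-0250-9, CercignaniIllnerPulvirenti1994, SaintRaymond2009, RezakhanlouVillani2008, Bobylev1997, MischlerWennberg1999, AlonsoEtAl2013, MischlerMouhot2012, BobylevGambaPanferov2004, NachtergaeleYau2003, GST2013, BodineauGallagherSaintRaymondInvent2016]

Barriers (technique_class: povzner-moments, contact-intensity, a-priori-estimates): - technique_class: povzner-moments, contact-intensity, a-priori-estimates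
- Literature.Barriers.AtomisticToContinuum.HighMomentumCutoffBarrier: APPLIES AND IS THE TARGET —
the route proves the barrier file's open auxiliary hypothesis (evasion (iii) made unconditional) in
the conjunct's closure: GaussianVelocityTails is the body of HighMomentumCutoff σ with σ₀ after the
profiles, and TailsOfHighMomentumCutoff records HighMomentumCutoff ⇒ GaussianVelocityTails; nothing
printed is contradicted (the barrier is a scope restriction of OVY's class IsOVYKineticEnergy plus
NY's "no proof", not an impossibility); the kinetic energy is NOT modified and no entropy truncation
is used — tails are controlled dynamically through the hard-sphere growth of the collision rate with
speed.
- Literature.Barriers.AtomisticToContinuum.HighMomentumCutoffBarrierNarrow: consistent with the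
narrowing (scope caveat (f)): the obstruction is the cubic convective energy current, and what is
asked is a Gaussian a priori bound along the true evolution — exactly GaussianVelocityTails; the
exp-cubic order-N form of 0781 (infinite at t = 0) is NOT used anywhere in this route.
- Literature.Barriers.AtomisticToContinuum.BoltzmannHypothesisBarrier: not met by the module — no
closure of currents by Gibbs expectations and no classification of stationary states is attempted;
molecular chaos enters only as one-sided constant-factor INEQUALITIES on the collision intensity
(cruxes 2–4), mostly for fast spheres; it IS met

History (route lifecycle, newest last):
- 2026-08-15T13:38:28Z · CLOSED retired — not-a-thesis: assembly does not conclude the sub-problem Statement (operator:999:1257524)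

sub-problem: HydrodynamicLimit · status: closed(retired) · opened planner-plancard-AtomisticToContinuum-Hydrody-f74c4575-0 2026-08-15T11:34:36Z · rev 0 · ledger route-AtomisticToContinuum-AprioriTailsRattlers
GENERATED by the gate from the ledger (D-0016/17). Provers cite these decls: `theorem foo : Summit.AtomisticToContinuum.HydrodynamicLimit.Theses.AprioriTailsRattlers.<Decl> := …` in Summits/AtomisticToContinuum/HydrodynamicLimit/Theorems/<Name>.lean.
-/

namespace Summit.AtomisticToContinuum.HydrodynamicLimit.Theses.AprioriTailsRattlers

open scoped BigOperators Topology Manifold Classical MeasureTheory ProbabilityTheory Matrix InnerProductSpace ComplexConjugate ContinuousMap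
open Filter Set Function TopologicalSpace MeasureTheory

attribute [summit_statement] _root_.HydrodynamicLimit

/-- item stmt-AtomisticToContinuum-4603 · crux · rank 2 · closed · moot by None · by planner
why it might fail: Channelling: dynamically created fast spheres might sit in co-moving or depleted corridors (wakes, jets) and collide at mean rate ≪ ν_N|v|; entropy cannot exclude it (tail energy is entropically free) and no lower bound on collision rates of a sub-population of a deterministic gas is in print.
sources: Spohn1991, BodineauGallagherSaintRaymondInvent2016, GST2013, MischlerMouhot2012
[crux] LOSS / NO CHANNELLING (card cruxes 1–2, rate part): for all profiles ∃σ₀ ∀σ<σ₀ ∀T ∀flows ∃K₀,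
c>0, N₀ such that for N ≥ N₀, every p ∈ ℕ and 0 ≤ s ≤ t ≤ T: c·σ²(N+1)^{1/3}·∫_s^t E[(N+1)⁻¹
Σ_{i:|vᵢ(τ)|>K₀} |vᵢ(τ)|^{2p+1}] dτ ≤ E[Σ over collisions in (s,t] and ordered contact pairs (i,j)
of 1{|vᵢ⁻|>K₀}(N+1)⁻¹|vᵢ⁻|^{2p}] (pre-collisional velocity vᵢ⁻ = collidePair of the post
configuration): fast spheres collide at rate at least c ν_N |v|, in the |v|^{2p}-weighted
time-integrated mean, uniformly in p — a fast sphere sweeps volume πε²|v|dt of fresh, frozen,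
locally-Gibbs targets (Lorentz gas). [difficulty: open-problem] -/
@[route_item "route-AtomisticToContinuum-AprioriTailsRattlers"]
def FastParticleCollisionRate : Prop :=
  ∀ (a₀ θ₀ : Literature.MathematicalPhysics.KineticTheory.T3 → ℝ) (u₀ : Literature.MathematicalPhysics.KineticTheory.T3 → Literature.MathematicalPhysics.KineticTheory.V3), Continuous a₀ → Continuous θ₀ → Continuous u₀ → (∀ x, 0 < a₀ x) → (∀ x, 0 < θ₀ x) → ∃ σ₀ : ℝ, 0 < σ₀ ∧ ∀ σ : ℝ, 0 < σ → σ < σ₀ → ∀ T : ℝ, 0 < T → ∀ Φ : ((N : ℕ) → Literature.Analysis.FluidPDE.HardSphereFlow (Literature.Analysis.FluidPDE.Torus.geometry (Fin 3)) (Literature.MathematicalPhysics.KineticTheory.hsDiameter σ N) (N + 1)), ∃ K₀ : ℝ, 0 ≤ K₀ ∧ ∃ c : ℝ, 0 < c ∧ ∃ N₀ : ℕ, ∀ N : ℕ, N₀ ≤ N → ∀ p : ℕ, ∀ s t : ℝ, 0 ≤ s → s ≤ t → t ≤ T → ENNReal.ofReal (c * (σ ^ 2 * ((N + 1 : ℕ)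 : ℝ) ^ ((1 : ℝ) / 3))) * ∫⁻ τ in Set.Ioc s t, (∫⁻ z, ENNReal.ofReal (((N + 1 : ℕ) : ℝ)⁻¹ * ∑ i : Fin (N + 1), if K₀ < ‖((((Φ N).flow τ z)) i).2‖ then ‖((((Φ N).flow τ z)) i).2‖ ^ (2 * p + 1) else 0) ∂(Literature.MathematicalPhysics.KineticTheory.localGibbsLaw σ a₀ u₀ θ₀ N (Φ N))) ≤ (∫⁻ z, (∑ᶠ τ ∈ Literature.Analysis.FluidPDE.collisionTimes (Literature.Analysis.FluidPDE.Torus.geometry (Fin 3)) (Literature.MathematicalPhysics.KineticTheory.hsDiameter σ N) (fun r => (Φ N).flow r z) ∩ Set.Ioc s t, ∑ i : Fin (N + 1), ∑ j : Fin (N + 1), if i = j then (0 : ENNReal) else (Literature.Analysis.FluidPDE.contactSet (Literature.Analysis.FluidPDE.Torus.geometry (Fin 3)) (N + 1) (Literature.MathematicalPhysics.KineticTheory.hsDiameter σ N) i j).indicator (fun y => if K₀ < ‖(((Literature.Analysis.FluidPDE.collidePair (Literature.Analysis.FluidPDE.Torus.geometry (Fin 3)) i j y)) i).2‖ then ENNReal.ofReal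 (((N + 1 : ℕ) : ℝ)⁻¹ * ‖(((Literature.Analysis.FluidPDE.collidePair (Literature.Analysis.FluidPDE.Torus.geometry (Fin 3)) i j y)) i).2‖ ^ (2 * p)) else 0) ((Φ N).flow τ z)) ∂(Literature.MathematicalPhysics.KineticTheory.localGibbsLaw σ a₀ u₀ θ₀ N (Φ N)))

/-- item stmt-AtomisticToContinuum-4604 · crux · rank 3 · closed · moot by None · by planner
why it might fail: Sub-LD clustering: transient micro-clusters (rattlers) or velocity-correlated incoming pairs formed along f_t could push the time-averaged contact trace above C|v−w|F⊗F; needs L∞-type control of the pair trace at contact, open beyond Lanford time; focusing inflates C (∝ 1/hot-spot volume).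
sources: GST2013, PulvirentiSimonella2016, BuragoFerlegerKononenko1998, Alexander1975, Spohn1991
[crux] GAIN / RATTLERS = (R): for all profiles ∃σ₀ ∀σ<σ₀ ∀T ∀flows ∃C<∞, N₀ such that for N ≥ N₀, 0
≤ s ≤ t ≤ T and every continuous φ : V3×V3 → [0,∞]: E[Σ_{collisions in (s,t]} Σ_{ordered contact
pairs (i,j)} φ(vᵢ⁻, vⱼ⁻)] ≤ C·(ν_N/(N+1))·∫_s^t E⊗E[Σᵢ Σⱼ φ(vᵢ(τ,z), vⱼ(τ,z′))·|vᵢ(τ,z) − vⱼ(τ,z′)|]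
dτ (two independent copies z, z′ of the initial law): the time-integrated incoming contact intensity
of f_τ^{(2)} is dominated by C × the Boltzmann–Enskog intensity ν_N|v−w|F_τ⊗F_τ of the mean
one-particle velocity law. With φ ≡ 1 it bounds the mean collision count by C×Enskog, with φ =
ε|v−w| the mean collisional impulse (MeanCollisionalImpulseBound), with φ = mixed binomial monomials
the gain term of the Povzner hierarchy. [difficulty: open-problem] -/
@[route_item "route-AtomisticToContinuum-AprioriTailsRattlers"]
def ContactIntensityDomination : Prop :=
  ∀ (a₀ θ₀ : Literature.MathematicalPhysics.KineticTheory.T3 → ℝ) (u₀ : Literature.MathematicalPhysics.KineticTheory.T3 → Literature.MathematicalPhysics.KineticTheory.V3), Continuous a₀ → Continuous θ₀ → Continuous u₀ → (∀ x, 0 < a₀ x) → (∀ x, 0 < θ₀ x) → ∃ σ₀ : ℝ, 0 < σ₀ ∧ ∀ σ : ℝ, 0 < σ → σ < σ₀ → ∀ T : ℝ, 0 < T → ∀ Φ : ((N : ℕ) → Literature.Analysis.FluidPDE.HardSphereFlow (Literature.Analysis.FluidPDE.Torus.geometry (Fin 3)) (Literature.MathematicalPhysics.KineticTheory.hsDiameter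 σ N) (N + 1)), ∃ C : ENNReal, C < ⊤ ∧ ∃ N₀ : ℕ, ∀ N : ℕ, N₀ ≤ N → ∀ s t : ℝ, 0 ≤ s → s ≤ t → t ≤ T → ∀ φ : Literature.MathematicalPhysics.KineticTheory.V3 × Literature.MathematicalPhysics.KineticTheory.V3 → ENNReal, Continuous φ → (∫⁻ z, (∑ᶠ τ ∈ Literature.Analysis.FluidPDE.collisionTimes (Literature.Analysis.FluidPDE.Torus.geometry (Fin 3)) (Literature.MathematicalPhysics.KineticTheory.hsDiameter σ N) (fun r => (Φ N).flow r z) ∩ Set.Ioc s t, ∑ i : Fin (N + 1), ∑ j : Fin (N + 1), if i = j then (0 : ENNReal) else (Literature.Analysis.FluidPDE.contactSet (Literature.Analysis.FluidPDE.Torus.geometry (Fin 3)) (N + 1) (Literature.MathematicalPhysics.KineticTheory.hsDiameter σ N) i j).indicator (fun y => φ ((((Literature.Analysis.FluidPDE.collidePair (Literature.Analysis.FluidPDE.Torus.geometry (Fin 3)) i j y)) i).2, (((Literature.Analysis.FluidPDE.collidePair (Literature.Analysis.FluidPDE.Torus.geometry (Fin 3)) i j y)) j).2)) ((Φ N).flow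 τ z)) ∂(Literature.MathematicalPhysics.KineticTheory.localGibbsLaw σ a₀ u₀ θ₀ N (Φ N))) ≤ C * ENNReal.ofReal ((σ ^ 2 * ((N + 1 : ℕ) : ℝ) ^ ((1 : ℝ) / 3)) / ((N + 1 : ℕ) : ℝ)) * ∫⁻ τ in Set.Ioc s t, (∫⁻ z, ∫⁻ z', (∑ i : Fin (N + 1), ∑ j : Fin (N + 1), φ (((((Φ N).flow τ z)) i).2, ((((Φ N).flow τ z')) j).2) * ENNReal.ofReal ‖((((Φ N).flow τ z)) i).2 - ((((Φ N).flow τ z')) j).2‖) ∂(Literature.MathematicalPhysics.KineticTheory.localGibbsLaw σ a₀ u₀ θ₀ N (Φ N)) ∂(Literature.MathematicalPhysics.KineticTheory.localGibbsLaw σ a₀ u₀ θ₀ N (Φ N)))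

/-- item stmt-AtomisticToContinuum-4605 · crux · rank 4 · closed · moot by None · by planner
why it might fail: Grazing-dominated statistics for energetic collisions (a fast sphere skimming a wake; impact parameters piling up near b = ε) push the weighted mean of u^p+(1−u)^p to 1 and kill the 1/(p+1) decay; then only order-1 exponential tails survive and crux 5 does not apply as stated.
sources: CercignaniIllnerPulvirenti1994, BobylevGambaPanferov2004, GST2013
[crux] ANGULAR (card crux 1, non-grazing in the mean, in the form the moment method consumes): ∃C<∞,
N₀: for N ≥ N₀, p ≥ 1, 0 ≤ s ≤ t ≤ T: E[Σ_coll Σ_ord (N+1)⁻¹(|vᵢ⁺|^{2p}+|vⱼ⁺|^{2p})] ≤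
(C/(p+1))·E[Σ_coll Σ_ord (N+1)⁻¹(|vᵢ⁺|²+|vⱼ⁺|²)^p], i.e. the pair-energy^p-weighted collision
average of h_p(u⁺) = (u⁺)^p + (1−u⁺)^p (u⁺ = post-collisional energy fraction) decays like 1/(p+1).
Kinematics (NOTES): for hard spheres with impact parameter uniform on the disk, u⁺ is uniform on an
interval centred at 1/2 of width 2|V||g|/E, so E_ω h_p(u⁺) ≤ 2/(p+1) for EVERY pre-collisional pair;
hence the crux follows from a bounded density of the impact-parameter law (w.r.t. uniform) in the
E^p-weighted collision mean; rattling co-moving pairs have u⁺ ≈ 1/2 and are harmless here.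
[difficulty: L] -/
@[route_item "route-AtomisticToContinuum-AprioriTailsRattlers"]
def EnergySplitEquidistribution : Prop :=
  ∀ (a₀ θ₀ : Literature.MathematicalPhysics.KineticTheory.T3 → ℝ) (u₀ : Literature.MathematicalPhysics.KineticTheory.T3 → Literature.MathematicalPhysics.KineticTheory.V3), Continuous a₀ → Continuous θ₀ → Continuous u₀ → (∀ x, 0 < a₀ x) → (∀ x, 0 < θ₀ x) → ∃ σ₀ : ℝ, 0 < σ₀ ∧ ∀ σ : ℝ, 0 < σ → σ < σ₀ → ∀ T : ℝ, 0 < T → ∀ Φ : ((N : ℕ) → Literature.Analysis.FluidPDE.HardSphereFlow (Literature.Analysis.FluidPDE.Torus.geometry (Fin 3)) (Literature.MathematicalPhysics.KineticTheory.hsDiameter σ N) (N + 1)), ∃ C : ENNReal, C < ⊤ ∧ ∃ N₀ : ℕ, ∀ N : ℕ, N₀ ≤ N → ∀ p : ℕ, 1 ≤ p → ∀ s t : ℝ, 0 ≤ s → s ≤ t → t ≤ T → (∫⁻ z, (∑ᶠ τ ∈ Literature.Analysis.FluidPDE.collisionTimes (Literature.Analysis.FluidPDE.Torus.geometry (Fin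 3)) (Literature.MathematicalPhysics.KineticTheory.hsDiameter σ N) (fun r => (Φ N).flow r z) ∩ Set.Ioc s t, ∑ i : Fin (N + 1), ∑ j : Fin (N + 1), if i = j then (0 : ENNReal) else (Literature.Analysis.FluidPDE.contactSet (Literature.Analysis.FluidPDE.Torus.geometry (Fin 3)) (N + 1) (Literature.MathematicalPhysics.KineticTheory.hsDiameter σ N) i j).indicator (fun y => ENNReal.ofReal (((N + 1 : ℕ) : ℝ)⁻¹ * (‖(y i).2‖ ^ (2 * p) + ‖(y j).2‖ ^ (2 * p)))) ((Φ N).flow τ z)) ∂(Literature.MathematicalPhysics.KineticTheory.localGibbsLaw σ a₀ u₀ θ₀ N (Φ N))) ≤ C / ((p : ENNReal) + 1) * (∫⁻ z, (∑ᶠ τ ∈ Literature.Analysis.FluidPDE.collisionTimes (Literature.Analysis.FluidPDE.Torus.geometry (Fin 3)) (Literature.MathematicalPhysics.KineticTheory.hsDiameter σ N) (fun r => (Φ N).flow r z) ∩ Set.Ioc s t, ∑ i : Fin (N + 1), ∑ j : Fin (N + 1), if i = j then (0 : ENNReal) else (Literature.Analysis.FluidPDE.contactSet (Literature.Analysis.FluidPDE.Torus.geometry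 (Fin 3)) (N + 1) (Literature.MathematicalPhysics.KineticTheory.hsDiameter σ N) i j).indicator (fun y => ENNReal.ofReal (((N + 1 : ℕ) : ℝ)⁻¹ * (‖(y i).2‖ ^ 2 + ‖(y j).2‖ ^ 2) ^ p)) ((Φ N).flow τ z)) ∂(Literature.MathematicalPhysics.KineticTheory.localGibbsLaw σ a₀ u₀ θ₀ N (Φ N)))

/-- item stmt-AtomisticToContinuum-4606 · crux · rank 5 · closed · moot by None · by planner
why it might fail: The abstraction may be too weak (hierarchy only from p₀ on, loss/gain constants decoupled, no time-continuity, mass ≤ 1 not = 1): if order-2 summability fails under exactly these hypotheses the conclusion drops to exp(b|v|) moments and the item must be restated (grounder check vs BGP04/ACGM13).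
sources: Bobylev1997, BobylevGambaPanferov2004, AlonsoEtAl2013, GambaPanferovVillani2009, MischlerWennberg1999, CercignaniIllnerPulvirenti1994
[crux] ABSTRACT PROPAGATION LEMMA (pure analysis; Bobylev–Gamba–Panferov / ACGM uniform-in-time
Gaussian propagation, abstracted from the kernel): for all p₀, K₀ ≥ 0, c > 0, C ≥ 0, E₀, C₀, A there
are b > 0, B < ∞ such that for every ν > 0, horizon S and family u ↦ μ_u of measures on ℝ³ with mass
≤ 1, second moments ≤ E₀ on [0,S], each even moment bounded on [0,S], Gaussian initial moments
M_{2p}(0) ≤ C₀A^p p!, and the integrated hierarchy M_{2p}(u₂) + cν∫_{u₁}^{u₂}M_{2p+1} ≤ M_{2p}(u₁) +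
ν∫_{u₁}^{u₂}[C K₀^{2p+1} + (C/(p+1)) Σ_{0<k<p} C(p,k)(M_{2k+1}M_{2p−2k} + M_{2k}M_{2p−2k+1})] for p
≥ p₀, 0 ≤ u₁ ≤ u₂ ≤ S: sup_{u≤S} ∫exp(b|v|²)dμ_u ≤ B — b, B independent of ν, S, μ (ν only rescales
time; the comparison bounds are sup-bounds). This is the item provers can close now; it converts
PovznerHierarchy into GaussianVelocityTails (HierarchyToGaussian). [difficulty: L] -/
@[route_item "route-AtomisticToContinuum-AprioriTailsRattlers"]
def AbstractPovznerGaussian : Prop :=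
  ∀ (p₀ : ℕ) (K₀ c C E₀ C₀ A : ℝ), 0 ≤ K₀ → 0 < c → 0 ≤ C → ∃ b : ℝ, 0 < b ∧ ∃ B : ENNReal, B < ⊤ ∧ ∀ (ν S : ℝ), 0 < ν → ∀ μ : ℝ → MeasureTheory.Measure Literature.MathematicalPhysics.KineticTheory.V3, (∀ u, μ u Set.univ ≤ 1) → (∀ u ∈ Set.Icc 0 S, (∫⁻ v, ENNReal.ofReal (‖v‖ ^ (2)) ∂(μ u)) ≤ ENNReal.ofReal E₀) → (∀ p : ℕ, ∃ D : ℝ, ∀ u ∈ Set.Icc 0 S, (∫⁻ v, ENNReal.ofReal (‖v‖ ^ (2 * p)) ∂(μ u)) ≤ ENNReal.ofReal D) → (∀ p : ℕ, (∫⁻ v, ENNReal.ofReal (‖v‖ ^ (2 * p)) ∂(μ 0)) ≤ ENNReal.ofReal (C₀ * A ^ p * (p.factorial : ℝ))) → (∀ p : ℕ, p₀ ≤ p → ∀ u₁ u₂ : ℝ, 0 ≤ u₁ → u₁ ≤ u₂ → u₂ ≤ S → (∫⁻ v, ENNReal.ofReal (‖v‖ ^ (2 * p)) ∂(μ u₂))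 + ENNReal.ofReal (c * ν) * ∫⁻ u in Set.Ioc u₁ u₂, (∫⁻ v, ENNReal.ofReal (‖v‖ ^ (2 * p + 1)) ∂(μ u)) ≤ (∫⁻ v, ENNReal.ofReal (‖v‖ ^ (2 * p)) ∂(μ u₁)) + ENNReal.ofReal ν * ∫⁻ u in Set.Ioc u₁ u₂, (ENNReal.ofReal (C * K₀ ^ (2 * p + 1)) + ENNReal.ofReal (C / ((p : ℝ) + 1)) * (∑ k ∈ Finset.Ioo 0 p, ((p.choose k : ℕ) : ENNReal) * ((∫⁻ v, ENNReal.ofReal (‖v‖ ^ (2 * k + 1)) ∂(μ u)) * (∫⁻ v, ENNReal.ofReal (‖v‖ ^ (2 * p - 2 * k)) ∂(μ u)) + (∫⁻ v, ENNReal.ofReal (‖v‖ ^ (2 * k)) ∂(μ u)) * (∫⁻ v, ENNReal.ofReal (‖v‖ ^ (2 * p - 2 * k + 1)) ∂(μ u)))))) → ∀ u ∈ Set.Icc 0 S, (∫⁻ v, ENNReal.ofReal (Real.exp (b * ‖v‖ ^ 2)) ∂(μ u)) ≤ B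

/-- item stmt-AtomisticToContinuum-4607 · support · rank 9 · closed · moot by None · by planner
sources: NachtergaeleYau2003, OllaVaradhanYau1993
[support] (T), the module's tail output: for all profiles ∃σ₀ ∀σ<σ₀ ∀T>0 ∀flows ∃c>0, C<∞, N₀: ∀N ≥
N₀ ∀t ∈ [0,T], ∫ expVelocityMoment c (Φ_N(t) z) dλ^N ≤ C — the body of
Literature.Barriers.AtomisticToContinuum.HighMomentumCutoff σ with the conjunct's closure (σ₀ after
the profiles, N ≥ N₀); wanted by RelEntropyErgodic (restated 0781), VanishingNoise, ChaoticMixing,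
chapman-enskog-corrector, kinetic-windows-inside-yau, first-failure-blowup,
spacetime-superextensive-ld (max-speed corollary). Obtained here as HierarchyToGaussian ∘
MomentBookkeeping. [difficulty: open-problem] -/
@[route_item "route-AtomisticToContinuum-AprioriTailsRattlers"]
def GaussianVelocityTails : Prop :=
  ∀ (a₀ θ₀ : Literature.MathematicalPhysics.KineticTheory.T3 → ℝ) (u₀ : Literature.MathematicalPhysics.KineticTheory.T3 → Literature.MathematicalPhysics.KineticTheory.V3), Continuous a₀ → Continuous θ₀ → Continuous u₀ → (∀ x, 0 < a₀ x) → (∀ x, 0 < θ₀ x) → ∃ σ₀ : ℝ, 0 < σ₀ ∧ ∀ σ : ℝ, 0 < σ → σ < σ₀ → ∀ T : ℝ, 0 < T → ∀ Φ : ((N : ℕ) → Literature.Analysis.FluidPDE.HardSphereFlow (Literature.Analysis.FluidPDE.Torus.geometry (Fin 3)) (Literature.MathematicalPhysics.KineticTheory.hsDiameter σ N) (N + 1)), ∃ c : ℝ, 0 < c ∧ ∃ C : ENNReal, C < ⊤ ∧ ∃ N₀ : ℕ, ∀ N : ℕ, N₀ ≤ N → ∀ t ∈ Set.Icc 0 T,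 (∫⁻ z, Literature.Barriers.AtomisticToContinuum.expVelocityMoment c ((Φ N).flow t z) ∂(Literature.MathematicalPhysics.KineticTheory.localGibbsLaw σ a₀ u₀ θ₀ N (Φ N))) ≤ C

/-- item stmt-AtomisticToContinuum-4608 · support · rank 9 · closed · moot by None · by planner
sources: Bobylev1997, BobylevGambaPanferov2004, AlonsoEtAl2013
[support] HUB STATEMENT (typed N-body-in-the-mean Povzner system; = glue target of
MomentBookkeeping, hypothesis of HierarchyToGaussian; direct attack welcome): for all profiles ∃σ₀
∀σ<σ₀ ∀T ∀flows ∃p₀, K₀≥0, c>0, C≥0, E₀, C₀, A, N₀ such that for N ≥ N₀, with M_r(τ) :=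
E[(N+1)⁻¹Σᵢ|vᵢ(τ)|^r] and ν = σ²(N+1)^{1/3}: mass λ^N(univ) ≤ 1; M_2 ≤ E₀ on [0,T]; each M_{2p}
bounded on [0,T] (N-dependent bound allowed); M_{2p}(0) ≤ C₀A^p p!; and for p ≥ p₀, 0 ≤ s ≤ t ≤ T:
M_{2p}(t) + cν∫_s^t M_{2p+1} ≤ M_{2p}(s) + ν∫_s^t [C K₀^{2p+1} + (C/(p+1))·S_p], S_p = Σ_{0<k<p}
C(p,k)(M_{2k+1}M_{2p−2k} + M_{2k}M_{2p−2k+1}) (BGP form with γ_p ≤ C/(p+1)). [difficulty: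
open-problem] -/
@[route_item "route-AtomisticToContinuum-AprioriTailsRattlers"]
def PovznerHierarchy : Prop :=
  ∀ (a₀ θ₀ : Literature.MathematicalPhysics.KineticTheory.T3 → ℝ) (u₀ : Literature.MathematicalPhysics.KineticTheory.T3 → Literature.MathematicalPhysics.KineticTheory.V3), Continuous a₀ → Continuous θ₀ → Continuous u₀ → (∀ x, 0 < a₀ x) → (∀ x, 0 < θ₀ x) → ∃ σ₀ : ℝ, 0 < σ₀ ∧ ∀ σ : ℝ, 0 < σ → σ < σ₀ → ∀ T : ℝ, 0 < T → ∀ Φ : ((N : ℕ) → Literature.Analysis.FluidPDE.HardSphereFlow (Literature.Analysis.FluidPDE.Torus.geometry (Fin 3)) (Literature.MathematicalPhysics.KineticTheory.hsDiameter σ N) (N + 1)), ∃ p₀ : ℕ, ∃ K₀ : ℝ, ∃ c : ℝ, ∃ C : ℝ, ∃ E₀ : ℝ, ∃ C₀ : ℝ, ∃ A : ℝ, 0 ≤ K₀ ∧ 0 < c ∧ 0 ≤ C ∧ ∃ N₀ : ℕ, ∀ N : ℕ, N₀ ≤ N → (Literature.MathematicalPhysics.KineticTheory.localGibbsLaw σ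 a₀ u₀ θ₀ N (Φ N)) Set.univ ≤ 1 ∧ (∀ τ ∈ Set.Icc 0 T, (∫⁻ z, ENNReal.ofReal (((N + 1 : ℕ) : ℝ)⁻¹ * ∑ i : Fin (N + 1), ‖((((Φ N).flow τ z)) i).2‖ ^ (2)) ∂(Literature.MathematicalPhysics.KineticTheory.localGibbsLaw σ a₀ u₀ θ₀ N (Φ N))) ≤ ENNReal.ofReal E₀) ∧ (∀ p : ℕ, ∃ D : ℝ, ∀ τ ∈ Set.Icc 0 T, (∫⁻ z, ENNReal.ofReal (((N + 1 : ℕ) : ℝ)⁻¹ * ∑ i : Fin (N + 1), ‖((((Φ N).flow τ z)) i).2‖ ^ (2 * p)) ∂(Literature.MathematicalPhysics.KineticTheory.localGibbsLaw σ a₀ u₀ θ₀ N (Φ N))) ≤ ENNReal.ofReal D) ∧ (∀ p : ℕ, (∫⁻ z, ENNReal.ofReal (((N + 1 : ℕ) : ℝ)⁻¹ * ∑ i : Fin (N + 1), ‖((((Φ N).flow 0 z)) i).2‖ ^ (2 * p)) ∂(Literature.MathematicalPhysics.KineticTheory.localGibbsLaw σ a₀ u₀ θ₀ N (Φ N)))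 ≤ ENNReal.ofReal (C₀ * A ^ p * (p.factorial : ℝ))) ∧ (∀ p : ℕ, p₀ ≤ p → ∀ s t : ℝ, 0 ≤ s → s ≤ t → t ≤ T → (∫⁻ z, ENNReal.ofReal (((N + 1 : ℕ) : ℝ)⁻¹ * ∑ i : Fin (N + 1), ‖((((Φ N).flow t z)) i).2‖ ^ (2 * p)) ∂(Literature.MathematicalPhysics.KineticTheory.localGibbsLaw σ a₀ u₀ θ₀ N (Φ N))) + ENNReal.ofReal (c * (σ ^ 2 * ((N + 1 : ℕ) : ℝ) ^ ((1 : ℝ) / 3))) * ∫⁻ τ in Set.Ioc s t, (∫⁻ z, ENNReal.ofReal (((N + 1 : ℕ) : ℝ)⁻¹ * ∑ i : Fin (N + 1), ‖((((Φ N).flow τ z)) i).2‖ ^ (2 * p + 1)) ∂(Literature.MathematicalPhysics.KineticTheory.localGibbsLaw σ a₀ u₀ θ₀ N (Φ N))) ≤ (∫⁻ z, ENNReal.ofReal (((N + 1 : ℕ) : ℝ)⁻¹ * ∑ i : Fin (N + 1), ‖((((Φ N).flow s z)) i).2‖ ^ (2 * p)) ∂(Literature.MathematicalPhysics.KineticTheory.localGibbsLaw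 σ a₀ u₀ θ₀ N (Φ N))) + ENNReal.ofReal (σ ^ 2 * ((N + 1 : ℕ) : ℝ) ^ ((1 : ℝ) / 3)) * ∫⁻ τ in Set.Ioc s t, (ENNReal.ofReal (C * K₀ ^ (2 * p + 1)) + ENNReal.ofReal (C / ((p : ℝ) + 1)) * (∑ k ∈ Finset.Ioo 0 p, ((p.choose k : ℕ) : ENNReal) * ((∫⁻ z, ENNReal.ofReal (((N + 1 : ℕ) : ℝ)⁻¹ * ∑ i : Fin (N + 1), ‖((((Φ N).flow τ z)) i).2‖ ^ (2 * k + 1)) ∂(Literature.MathematicalPhysics.KineticTheory.localGibbsLaw σ a₀ u₀ θ₀ N (Φ N))) * (∫⁻ z, ENNReal.ofReal (((N + 1 : ℕ) : ℝ)⁻¹ * ∑ i : Fin (N + 1), ‖((((Φ N).flow τ z)) i).2‖ ^ (2 * p - 2 * k)) ∂(Literature.MathematicalPhysics.KineticTheory.localGibbsLaw σ a₀ u₀ θ₀ N (Φ N))) + (∫⁻ z, ENNReal.ofReal (((N + 1 : ℕ) : ℝ)⁻¹ * ∑ i : Fin (N + 1), ‖((((Φ N).flow τ z)) i).2‖ ^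 (2 * k)) ∂(Literature.MathematicalPhysics.KineticTheory.localGibbsLaw σ a₀ u₀ θ₀ N (Φ N))) * (∫⁻ z, ENNReal.ofReal (((N + 1 : ℕ) : ℝ)⁻¹ * ∑ i : Fin (N + 1), ‖((((Φ N).flow τ z)) i).2‖ ^ (2 * p - 2 * k + 1)) ∂(Literature.MathematicalPhysics.KineticTheory.localGibbsLaw σ a₀ u₀ θ₀ N (Φ N)))))))

/-- item stmt-AtomisticToContinuum-4609 · support · rank 9 · closed · moot by None · by planner
sources: Spohn1991, GST2013
[support] (R) AS CONSUMED (collisional stress / rattler payload is extensive): for all profiles ∃σ₀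
∀σ<σ₀ ∀T ∀flows ∃C<∞, N₀: for N ≥ N₀ and 0 ≤ s ≤ t ≤ T, E[Σ_{collisions in (s,t]} Σ_ord ε_N |vᵢ⁺ −
vᵢ⁻|] ≤ C·(N+1)·σ³·(t−s) (ε_N = σ(N+1)^{-1/3}; per collision this is 2ε|g·ω|; Enskog value ≍ Nσ³√θ
per unit time): the mean collisional momentum transfer per particle per unit macroscopic time is
O(σ³) — the tightness input of FluxClosure 0823 (DissipativeWeakStrong) and the collisional residual
of every Gronwall route; shared target with card serre-compensated-integrability-cluster-payload.
Follows from ContactIntensityDomination with φ = ε|v−w| and the energy bound (glue ≤ 60 lines, not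
filed). [difficulty: M] -/
@[route_item "route-AtomisticToContinuum-AprioriTailsRattlers"]
def MeanCollisionalImpulseBound : Prop :=
  ∀ (a₀ θ₀ : Literature.MathematicalPhysics.KineticTheory.T3 → ℝ) (u₀ : Literature.MathematicalPhysics.KineticTheory.T3 → Literature.MathematicalPhysics.KineticTheory.V3), Continuous a₀ → Continuous θ₀ → Continuous u₀ → (∀ x, 0 < a₀ x) → (∀ x, 0 < θ₀ x) → ∃ σ₀ : ℝ, 0 < σ₀ ∧ ∀ σ : ℝ, 0 < σ → σ < σ₀ → ∀ T : ℝ, 0 < T → ∀ Φ : ((N : ℕ) → Literature.Analysis.FluidPDE.HardSphereFlow (Literature.Analysis.FluidPDE.Torus.geometry (Fin 3)) (Literature.MathematicalPhysics.KineticTheory.hsDiameter σ N) (N + 1)), ∃ C : ENNReal, C < ⊤ ∧ ∃ N₀ : ℕ, ∀ N : ℕ, N₀ ≤ N → ∀ s t : ℝ, 0 ≤ s → s ≤ t → t ≤ T → (∫⁻ z, (∑ᶠ τ ∈ Literature.Analysis.FluidPDE.collisionTimes (Literature.Analysis.FluidPDE.Torus.geometry (Fin 3)) (Literature.MathematicalPhysics.KineticTheory.hsDiameter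 σ N) (fun r => (Φ N).flow r z) ∩ Set.Ioc s t, ∑ i : Fin (N + 1), ∑ j : Fin (N + 1), if i = j then (0 : ENNReal) else (Literature.Analysis.FluidPDE.contactSet (Literature.Analysis.FluidPDE.Torus.geometry (Fin 3)) (N + 1) (Literature.MathematicalPhysics.KineticTheory.hsDiameter σ N) i j).indicator (fun y => ENNReal.ofReal ((Literature.MathematicalPhysics.KineticTheory.hsDiameter σ N) * ‖(y i).2 - (((Literature.Analysis.FluidPDE.collidePair (Literature.Analysis.FluidPDE.Torus.geometry (Fin 3)) i j y)) i).2‖)) ((Φ N).flow τ z)) ∂(Literature.MathematicalPhysics.KineticTheory.localGibbsLaw σ a₀ u₀ θ₀ N (Φ N))) ≤ C * ((N + 1 : ℕ) : ENNReal) * ENNReal.ofReal (σ ^ 3 * (t - s))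

/-- item stmt-AtomisticToContinuum-4610 · support · rank 9 · closed · moot by None · by planner
sources: NachtergaeleYau2003
[support] LINK TO THE BARRIER CATALOGUE (provable now, pure logic): if the barrier file's open
hypothesis holds for all small σ, (∃σ₀>0 ∀σ∈(0,σ₀),
Literature.Barriers.AtomisticToContinuum.HighMomentumCutoff σ), then GaussianVelocityTails
(instantiate profiles, take the same σ₀, N₀ = 0). [difficulty: provable-now] -/
@[route_item "route-AtomisticToContinuum-AprioriTailsRattlers"]
def TailsOfHighMomentumCutoff : Prop :=
  (∃ σ₀ : ℝ, 0 < σ₀ ∧ ∀ σ : ℝ, 0 < σ → σ < σ₀ → Literature.Barriers.AtomisticToContinuum.HighMomentumCutoff σ) → GaussianVelocityTails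

/-- item stmt-AtomisticToContinuum-4611 · support · rank 9 · closed · moot by None · by planner
sources: AlonsoEtAl2013, BobylevGambaPanferov2004
[support] GLUE (T-side, layer 2 → layer 1): AbstractPovznerGaussian → PovznerHierarchy →
GaussianVelocityTails. Instantiate the abstract lemma with ν := σ²(N+1)^{1/3}, S := T and μ_u := the
mean empirical velocity law at time u, (N+1)⁻¹ Σᵢ (λ^N).map (z ↦ vᵢ(Φ_N(u)z)); its moments are the
M_r of PovznerHierarchy (lintegral over sum/smul/map, ofReal of a nonnegative sum), and
∫exp(b|v|²)dμ_t = ∫ expVelocityMoment b (Φ_N(t)z) dλ^N; b, B do not depend on N because they do not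
depend on ν, S, μ. [glue] [deps: AbstractPovznerGaussian, PovznerHierarchy, GaussianVelocityTails]
[difficulty: M] -/
@[route_item "route-AtomisticToContinuum-AprioriTailsRattlers"]
def HierarchyToGaussian : Prop :=
  AbstractPovznerGaussian → PovznerHierarchy → GaussianVelocityTails

/-- item stmt-AtomisticToContinuum-4612 · support · rank 9 · closed · moot by None · by planner
sources: CercignaniIllnerPulvirenti1994, GST2013, BobylevGambaPanferov2004
[support] GLUE (the pathwise heart; layer 2 → hub): FastParticleCollisionRate →
ContactIntensityDomination → EnergySplitEquidistribution → PovznerHierarchy. For good z the speeds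
are constant between the finitely many collisions in (s,t]
(IsHardSphereTrajectory.free/locFinite/binary) and each collision of the pair (i,j) with pair energy
E and post fraction u⁺ changes S_p = (N+1)⁻¹Σ|vᵢ|^{2p} by (N+1)⁻¹[E^p h_p(u⁺) − |vᵢ⁻|^{2p} −
|vⱼ⁻|^{2p}] (PathwisePovzner; pre = collidePair of post); hence M_{2p}(t) + E[Σ pure(pre)] =
M_{2p}(s) + E[Σ post-pure]; ANGULAR bounds E[Σ post-pure] ≤ γ_p E[Σ E^p] with γ_p = C_a/(p+1), E^p =
pure(pre) + mixed(pre), UPPER with φ = mixed_p bounds E[Σ mixed(pre)] ≤ C_u ν ∫ S_p (independent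
copies factorise) and also makes E[Σ E^p] finite at fixed N, LOWER bounds E[Σ pure(pre)] ≥
(c/2)ν∫(M_{2p+1} − K₀^{2p+1}); for p ≥ p₀ := ⌈2C_a⌉ this is the hierarchy with c′ = c/4, C′ =
max(c/2, C_aC_u/2). Mass ≤ 1, M_2 ≤ E₀ (energy conservation, configEnergy_eq_holds), finite-N bounds
D_p and Gaussian initial moments come from the explicit local Gibbs density. Measure-theoretic
plumbing (measurability of collision functionals as limits over partitions; exchange of finite s -/
@[route_item "route-AtomisticToContinuum-AprioriTailsRattlers"]
def MomentBookkeeping : Prop :=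
  FastParticleCollisionRate → ContactIntensityDomination → EnergySplitEquidistribution → PovznerHierarchy

/-- item stmt-AtomisticToContinuum-4613 · support · rank 9 · closed · moot by None · by planner
sources: OllaVaradhanYau1993, NachtergaeleYau2003, Spohn1991
[support] CONSUMER (not this route's bet; as hard as the flux routes that claim it):
GaussianVelocityTails → ContactIntensityDomination → HydrodynamicLimit — the conditional Euler limit
given the a priori module, i.e. what RelEntropyErgodic's Gronwall 0780 (given tails, in place of
0781), DissipativeWeakStrong's FluxClosure 0823 (given tightness of the flux measures),
kinetic-windows-inside-yau and ld-drude-flux-gibbsianity each promise; filed so that the Assembly is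
honest glue and so that those routes can attach (wanted_by). Nachtergaele–Yau's Thm 2.1 is the
printed template of such a conditional theorem (for fermions, with the ergodic input also assumed).
[deps: GaussianVelocityTails, ContactIntensityDomination] [difficulty: open-problem] -/
@[route_item "route-AtomisticToContinuum-AprioriTailsRattlers"]
def ConditionalEulerLimit : Prop :=
  GaussianVelocityTails → ContactIntensityDomination → Literature.MathematicalPhysics.KineticTheory.HydrodynamicLimit

/-- item stmt-AtomisticToContinuum-4614 · support · rank 9 · closed · moot by None · by planner
sources: CercignaniIllnerPulvirenti1994
[support] THE PER-COLLISION ALGEBRA (provable now from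
norm_sq_reflectVel_fst_add_norm_sq_reflectVel_snd and the binomial theorem): for the elastic
reflection (v′,w′) = reflectVel n (v,w) and p ≥ 1, |v′|^{2p} + |w′|^{2p} ≤ (|v|²+|w|²)^p, and
(|v|²+|w|²)^p = |v|^{2p} + |w|^{2p} + Σ_{0<k<p} C(p,k)|v|^{2k}|w|^{2p−2k}: post-collisional pure
moments are bounded by the conserved pair energy^p, which exceeds the pre-collisional pure moments
exactly by the mixed binomial terms — Povzner's inequality "generalizes the conservation of energy,
taking into account compensation between gain and loss" (CIP 1994 p. 172), valid along the
deterministic flow with no Stosszahlansatz. [difficulty: provable-now] -/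
@[route_item "route-AtomisticToContinuum-AprioriTailsRattlers"]
def PathwisePovzner : Prop :=
  ∀ (n v w : Literature.MathematicalPhysics.KineticTheory.V3) (p : ℕ), 1 ≤ p → ‖(Literature.Analysis.FluidPDE.reflectVel n (v, w)).1‖ ^ (2 * p) + ‖(Literature.Analysis.FluidPDE.reflectVel n (v, w)).2‖ ^ (2 * p) ≤ (‖v‖ ^ 2 + ‖w‖ ^ 2) ^ p ∧ (‖v‖ ^ 2 + ‖w‖ ^ 2) ^ p = ‖v‖ ^ (2 * p) + ‖w‖ ^ (2 * p) + ∑ k ∈ Finset.Ioo 0 p, (p.choose k : ℝ) * ‖v‖ ^ (2 * k) * ‖w‖ ^ (2 * p - 2 * k)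

/-- item stmt-AtomisticToContinuum-4615 · assembly · rank 1 · closed · moot by None · by planner
sources: Spohn1991, NachtergaeleYau2003
[assembly] FastParticleCollisionRate → ContactIntensityDomination → EnergySplitEquidistribution →
AbstractPovznerGaussian → MomentBookkeeping → HierarchyToGaussian → ConditionalEulerLimit →
HydrodynamicLimit (modus ponens ×7). -/
@[route_item "route-AtomisticToContinuum-AprioriTailsRattlers"]
def Assembly : Prop :=
  FastParticleCollisionRate → ContactIntensityDomination → EnergySplitEquidistribution → AbstractPovznerGaussian → MomentBookkeeping → HierarchyToGaussian → ConditionalEulerLimit → Literature.MathematicalPhysics.KineticTheory.HydrodynamicLimit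

end Summit.AtomisticToContinuum.HydrodynamicLimit.Theses.AprioriTailsRattlers
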